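import Literature.NumberTheory.DiophantineApproximation.PolylogTwoPointHermitePade
import Literature.NumberTheory.DiophantineApproximation.DilogHermitePadeArithmetic
import HarnessLib

/-!
# Type-I Hermite–Padé forms for `1, Li_s(1/N), Li_s(−1/N)` (`s ≤ w`) — integrality and size of the coefficients

Topic `Literature/NumberTheory/DiophantineApproximation`. For partial-fraction data `c` of the
weight-`w` PARITY kernel (`ParityPade.kernelH`, vocabulary in `PolylogTwoPointHermitePade.lean`; the
parity reduction of David–Hirata-Kohno–Kawashima 2020, Thm 2.1, at the two points `±1/N`) with
`d_n^{w−1−o} c_{o,p} ∈ ℤ` (`BallRivoal.IsInt w d_n c`, `d_n = lcm(1..n) = Nat.lcmUpto n`), the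
coefficients of the form `2^w Λ^{(w)}_n(1/M) = ∑_{o<w} a_o Li_{o+1}(1/M) + ∑_{o<w} b_o Θ_{o+1}(1/M) + a`
(`ParityPade.coefLi`, `ParityPade.coefTh`, `ParityPade.constH`) become integers after multiplication by
`d_n^w` (`isInt_lcmUpto_pow_mul_coefLi`, `isInt_lcmUpto_pow_mul_coefTh`, `isInt_lcmUpto_pow_mul_constH`:
the finite remainders have the denominators `(k+1)^{o+1}`, `k + 1 ≤ p/2 ≤ n`, at the odd pole indices
`p` and `(2k+1)^{o+1}`, `2k + 1 ≤ p − 1 ≤ n`, at the even ones, all dividing `d_n^{o+1}`), and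
`|a_o|, |b_o| ≤ (∑|c|) · 2^w · M^{n/2}` (`abs_coefLi_le`, `abs_coefTh_le`; natural division `n/2`,
the point of the parity reduction). Finally `prod_two_pow_le` is the crude bound
`∏_{s<w} 2^{(2s+5)n+1} ≤ 2^{w((2w+3)n+1)}` on the `ℓ¹`-estimate of the data. This is the two-point
counterpart of `PolylogHermitePadeForms.lean` (`PolylogPade.isInt_lcmUpto_pow_mul_coefW`,
`PolylogPade.isInt_lcmUpto_pow_mul_constW`, `PolylogPade.abs_coefW_le`). Everything is PROVED; no
definitions, no named facts.

References: S. David, N. Hirata-Kohno, M. Kawashima, *Can polylogarithms at algebraic points be linearly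
independent?*, Moscow J. Comb. Number Th. 9 (2020) 389–406, Thm 2.1 [DavidHirataKohnoKawashima2020];
T. Rivoal, C. R. Acad. Sci. Paris 331 (2000), §2 Lemme 5 (the integrality mechanism) [Rivoal2000];
E. M. Nikišin, Mat. Sb. 109 (1979).
-/

open Finset

namespace Literature.NumberTheory.DiophantineApproximation

namespace ParityPade

open Literature.NumberTheory.Transcendental

/-- **Integrality of the `Li`-coefficients**: `d_n^w · a_o ∈ ℤ` for `o < w`, from
`d_n^{w−1−o} c_{o,p} ∈ ℤ` (the other factors `2^{w−1−o} M^{p/2}` are naturals).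
[cite: Rivoal2000, §2 Lemme 5] -/
theorem isInt_lcmUpto_pow_mul_coefLi {w n : ℕ} {c : ℕ → ℕ → ℚ}
    (hc : BallRivoal.IsInt w (Nat.lcmUpto n) c) (M : ℕ) {o : ℕ} (ho : o < w) :
    ∃ z : ℤ, ((Nat.lcmUpto n : ℚ) ^ w) * coefLi n w c M o = z := by
  -- each summand is an integer
  have hterm : ∀ p ∈ range (n + 1), ∃ z : ℤ, ((Nat.lcmUpto n : ℚ) ^ w) *
      (if Odd p then c o p * 2 ^ (w - 1 - o) * (M : ℚ) ^ (p / 2) else 0) = z := by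
    intro p _
    split_ifs with hp
    · obtain ⟨z, hz⟩ := hc o p
      refine ⟨z * (Nat.lcmUpto n : ℤ) ^ (o + 1) * 2 ^ (w - 1 - o) * (M : ℤ) ^ (p / 2), ?_⟩
      have hdw : (Nat.lcmUpto n : ℚ) ^ w =
          (Nat.lcmUpto n : ℚ) ^ (w - 1 - o) * (Nat.lcmUpto n : ℚ) ^ (o + 1) := by
        rw [← pow_add]; congr 1; omega
      rw [hdw]
      push_cast
      rw [← hz]
      ring
    · exact ⟨0, by simp⟩
  choose! z hz using hterm
  refine ⟨∑ p ∈ range (n + 1), z p, ?_⟩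
  rw [coefLi, mul_sum, Int.cast_sum]
  exact sum_congr rfl fun p hp => hz p hp

/-- **Integrality of the `Θ`-coefficients**: `d_n^w · b_o ∈ ℤ` for `o < w`, from
`d_n^{w−1−o} c_{o,p} ∈ ℤ` (the other factors `2^w M^{p/2}` are naturals).
[cite: Rivoal2000, §2 Lemme 5] -/
theorem isInt_lcmUpto_pow_mul_coefTh {w n : ℕ} {c : ℕ → ℕ → ℚ}
    (hc : BallRivoal.IsInt w (Nat.lcmUpto n) c) (M : ℕ) {o : ℕ} (ho : o < w) :
    ∃ z : ℤ, ((Nat.lcmUpto n : ℚ) ^ w) * coefTh n w c M o = z := by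
  -- each summand is an integer
  have hterm : ∀ p ∈ range (n + 1), ∃ z : ℤ, ((Nat.lcmUpto n : ℚ) ^ w) *
      (if Even p then c o p * 2 ^ w * (M : ℚ) ^ (p / 2) else 0) = z := by
    intro p _
    split_ifs with hp
    · obtain ⟨z, hz⟩ := hc o p
      refine ⟨z * (Nat.lcmUpto n : ℤ) ^ (o + 1) * 2 ^ w * (M : ℤ) ^ (p / 2), ?_⟩
      have hdw : (Nat.lcmUpto n : ℚ) ^ w =
          (Nat.lcmUpto n : ℚ) ^ (w - 1 - o) * (Nat.lcmUpto n : ℚ) ^ (o + 1) := by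
        rw [← pow_add]; congr 1; omega
      rw [hdw]
      push_cast
      rw [← hz]
      ring
    · exact ⟨0, by simp⟩
  choose! z hz using hterm
  refine ⟨∑ p ∈ range (n + 1), z p, ?_⟩
  rw [coefTh, mul_sum, Int.cast_sum]
  exact sum_congr rfl fun p hp => hz p hp

/-- **Integrality of the constant term**: `d_n^w · a ∈ ℤ` (`M ≥ 1`), from `d_n^{w−1−o} c_{o,p} ∈ ℤ`
and `m^{o+1} ∣ d_n^{o+1}` for the denominators `m = k + 1 ≤ p/2 ≤ n` (odd `p`) and
`m = 2k + 1 ≤ p − 1 ≤ n` (even `p`, `k < p/2`) of the finite remainders.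
[cite: Rivoal2000, §2 Lemme 5] -/
theorem isInt_lcmUpto_pow_mul_constH {w n : ℕ} {c : ℕ → ℕ → ℚ}
    (hc : BallRivoal.IsInt w (Nat.lcmUpto n) c) {M : ℕ} (hM : 1 ≤ M) :
    ∃ z : ℤ, ((Nat.lcmUpto n : ℚ) ^ w) * constH n w c M = z := by
  have hM0 : (M : ℚ) ≠ 0 := by exact_mod_cast (show M ≠ 0 by omega)
  -- the elementary summands `c_{o,p} 2^{w-1-o} M^{p/2}/(M^{k+1} (k+1)^{o+1})` at the odd pole
  -- indices become integers
  have hodd : ∀ o ∈ range w, ∀ p ∈ range (n + 1), ∀ k ∈ range (p / 2),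
      ∃ z : ℤ, ((Nat.lcmUpto n : ℚ) ^ w) *
        (c o p * ((2 : ℚ) ^ (w - 1 - o) *
          ((M : ℚ) ^ (p / 2) / ((M : ℚ) ^ (k + 1) * ((k : ℚ) + 1) ^ (o + 1))))) = z := by
    intro o ho p hp k hk
    rw [mem_range] at ho hp hk
    obtain ⟨z, hz⟩ := hc o p
    obtain ⟨e, he⟩ : (k + 1) ∣ Nat.lcmUpto n :=
      Int.natCast_dvd_natCast.1 (DilogPade.natCast_dvd_lcmUpto (by omega) (by omega))
    have hk0 : ((k : ℚ) + 1) ≠ 0 := by positivity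
    refine ⟨z * (e : ℤ) ^ (o + 1) * 2 ^ (w - 1 - o) * (M : ℤ) ^ (p / 2 - (k + 1)), ?_⟩
    have hdw : (Nat.lcmUpto n : ℚ) ^ w =
        (Nat.lcmUpto n : ℚ) ^ (w - 1 - o) * (Nat.lcmUpto n : ℚ) ^ (o + 1) := by
      rw [← pow_add]; congr 1; omega
    have hd' : (Nat.lcmUpto n : ℚ) ^ (o + 1) = ((k : ℚ) + 1) ^ (o + 1) * (e : ℚ) ^ (o + 1) := by
      rw [← mul_pow]; congr 1; exact_mod_cast he
    have hMp : (M : ℚ) ^ (p / 2) = (M : ℚ) ^ (p / 2 - (k + 1)) * (M : ℚ) ^ (k + 1) := by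
      rw [← pow_add]; congr 1; omega
    rw [hdw, hd', hMp]
    push_cast
    rw [← hz]
    field_simp
  -- the elementary summands `c_{o,p} 2^w M^{p/2}/(M^{k+1} (2k+1)^{o+1})` at the even pole indices
  -- become integers
  have heven : ∀ o ∈ range w, ∀ p ∈ range (n + 1), ¬Odd p → ∀ k ∈ range (p / 2),
      ∃ z : ℤ, ((Nat.lcmUpto n : ℚ) ^ w) *
        (c o p * ((2 : ℚ) ^ w *
          ((M : ℚ) ^ (p / 2) / ((M : ℚ) ^ (k + 1) * (2 * (k : ℚ) + 1) ^ (o + 1))))) = z := by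
    intro o ho p hp hpo k hk
    rw [mem_range] at ho hp hk
    obtain ⟨r, hr⟩ := Nat.not_odd_iff_even.1 hpo
    obtain ⟨z, hz⟩ := hc o p
    obtain ⟨e, he⟩ : (2 * k + 1) ∣ Nat.lcmUpto n :=
      Int.natCast_dvd_natCast.1 (DilogPade.natCast_dvd_lcmUpto (by omega) (by omega))
    have hk0 : (2 * (k : ℚ) + 1) ≠ 0 := by positivity
    refine ⟨z * (e : ℤ) ^ (o + 1) * 2 ^ w * (M : ℤ) ^ (p / 2 - (k + 1)), ?_⟩
    have hdw : (Nat.lcmUpto n : ℚ) ^ w =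
        (Nat.lcmUpto n : ℚ) ^ (w - 1 - o) * (Nat.lcmUpto n : ℚ) ^ (o + 1) := by
      rw [← pow_add]; congr 1; omega
    have hd' : (Nat.lcmUpto n : ℚ) ^ (o + 1) =
        (2 * (k : ℚ) + 1) ^ (o + 1) * (e : ℚ) ^ (o + 1) := by
      rw [← mul_pow]; congr 1; exact_mod_cast he
    have hMp : (M : ℚ) ^ (p / 2) = (M : ℚ) ^ (p / 2 - (k + 1)) * (M : ℚ) ^ (k + 1) := by
      rw [← pow_add]; congr 1; omega
    rw [hdw, hd', hMp]
    push_cast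
    rw [← hz]
    field_simp
  -- sum over `k`
  have h1 : ∀ o ∈ range w, ∀ p ∈ range (n + 1), ∃ z : ℤ, ((Nat.lcmUpto n : ℚ) ^ w) *
      (c o p *
        (if Odd p then
          (2 : ℚ) ^ (w - 1 - o) *
            ∑ k ∈ range (p / 2), (M : ℚ) ^ (p / 2) / ((M : ℚ) ^ (k + 1) * ((k : ℚ) + 1) ^ (o + 1))
         else
          (2 : ℚ) ^ w *
            ∑ k ∈ range (p / 2),
              (M : ℚ) ^ (p / 2) / ((M : ℚ) ^ (k + 1) * (2 * (k : ℚ) + 1) ^ (o + 1)))) = z := by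
    intro o ho p hp
    split_ifs with hpo
    · choose! z hz using hodd o ho p hp
      refine ⟨∑ k ∈ range (p / 2), z k, ?_⟩
      rw [mul_sum, mul_sum, mul_sum, Int.cast_sum]
      exact sum_congr rfl fun k hk => hz k hk
    · choose! z hz using heven o ho p hp hpo
      refine ⟨∑ k ∈ range (p / 2), z k, ?_⟩
      rw [mul_sum, mul_sum, mul_sum, Int.cast_sum]
      exact sum_congr rfl fun k hk => hz k hk
  -- sum over `p`
  have h2 : ∀ o ∈ range w, ∃ z : ℤ, ((Nat.lcmUpto n : ℚ) ^ w) *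
      (∑ p ∈ range (n + 1), c o p *
        (if Odd p then
          (2 : ℚ) ^ (w - 1 - o) *
            ∑ k ∈ range (p / 2), (M : ℚ) ^ (p / 2) / ((M : ℚ) ^ (k + 1) * ((k : ℚ) + 1) ^ (o + 1))
         else
          (2 : ℚ) ^ w *
            ∑ k ∈ range (p / 2),
              (M : ℚ) ^ (p / 2) / ((M : ℚ) ^ (k + 1) * (2 * (k : ℚ) + 1) ^ (o + 1)))) = z := by
    intro o ho
    choose! z hz using h1 o ho
    refine ⟨∑ p ∈ range (n + 1), z p, ?_⟩
    rw [mul_sum, Int.cast_sum]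
    exact sum_congr rfl fun p hp => hz p hp
  -- sum over `o`
  choose! z hz using h2
  refine ⟨-∑ o ∈ range w, z o, ?_⟩
  rw [constH, mul_neg, mul_sum, Int.cast_neg, Int.cast_sum, neg_inj]
  exact sum_congr rfl fun o ho => hz o ho

/-- **Size of the `Li`-coefficients**: `|a_o| ≤ (∑_{o,p} |c_{o,p}|) · 2^w · M^{n/2}` for `M ≥ 1`,
`o < w` (`2^{w−1−o} ≤ 2^w`, `M^{p/2} ≤ M^{n/2}` in natural division). [folklore] -/
theorem abs_coefLi_le {w n : ℕ} (c : ℕ → ℕ → ℚ) {M : ℕ} (hM : 1 ≤ M) {o : ℕ} (ho : o < w) :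
    |coefLi n w c M o| ≤ BallRivoal.l1 n w c * 2 ^ w * (M : ℚ) ^ (n / 2) := by
  have hM' : (1 : ℚ) ≤ M := by exact_mod_cast hM
  calc |coefLi n w c M o|
      ≤ ∑ p ∈ range (n + 1), |(if Odd p then c o p * 2 ^ (w - 1 - o) * (M : ℚ) ^ (p / 2) else 0)| :=
        abs_sum_le_sum_abs _ _
    _ ≤ ∑ p ∈ range (n + 1), |c o p| * 2 ^ w * (M : ℚ) ^ (n / 2) := by
        refine sum_le_sum fun p hp => ?_
        have hMp : (M : ℚ) ^ (p / 2) ≤ (M : ℚ) ^ (n / 2) :=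
          pow_le_pow_right₀ hM' (Nat.div_le_div_right (Nat.lt_succ_iff.1 (mem_range.1 hp)))
        split_ifs with hpo
        · have h2 : (2 : ℚ) ^ (w - 1 - o) ≤ 2 ^ w := pow_le_pow_right₀ one_le_two (by omega)
          rw [abs_mul, abs_mul, abs_of_nonneg (by positivity : (0 : ℚ) ≤ 2 ^ (w - 1 - o)),
            abs_of_nonneg (by positivity : (0 : ℚ) ≤ (M : ℚ) ^ (p / 2))]
          exact mul_le_mul (mul_le_mul_of_nonneg_left h2 (abs_nonneg _)) hMp (by positivity)
            (by positivity)
        · rw [abs_zero]; positivity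
    _ = (∑ p ∈ range (n + 1), |c o p|) * 2 ^ w * (M : ℚ) ^ (n / 2) := by rw [sum_mul, sum_mul]
    _ ≤ BallRivoal.l1 n w c * 2 ^ w * (M : ℚ) ^ (n / 2) := by
        refine mul_le_mul_of_nonneg_right (mul_le_mul_of_nonneg_right ?_ (by positivity))
          (by positivity)
        rw [BallRivoal.l1]
        calc ∑ p ∈ range (n + 1), |c o p|
            = ∑ p ∈ range (n + 1), ∑ o' ∈ ({o} : Finset ℕ), |c o' p| := by simp
          _ ≤ ∑ p ∈ range (n + 1), ∑ o' ∈ range w, |c o' p| :=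
              sum_le_sum fun p _ => sum_le_sum_of_subset_of_nonneg
                (by simpa using ho) fun _ _ _ => abs_nonneg _

/-- **Size of the `Θ`-coefficients**: `|b_o| ≤ (∑_{o,p} |c_{o,p}|) · 2^w · M^{n/2}` for `M ≥ 1`,
`o < w` (`M^{p/2} ≤ M^{n/2}` in natural division). [folklore] -/
theorem abs_coefTh_le {w n : ℕ} (c : ℕ → ℕ → ℚ) {M : ℕ} (hM : 1 ≤ M) {o : ℕ} (ho : o < w) :
    |coefTh n w c M o| ≤ BallRivoal.l1 n w c * 2 ^ w * (M : ℚ) ^ (n / 2) := by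
  have hM' : (1 : ℚ) ≤ M := by exact_mod_cast hM
  calc |coefTh n w c M o|
      ≤ ∑ p ∈ range (n + 1), |(if Even p then c o p * 2 ^ w * (M : ℚ) ^ (p / 2) else 0)| :=
        abs_sum_le_sum_abs _ _
    _ ≤ ∑ p ∈ range (n + 1), |c o p| * 2 ^ w * (M : ℚ) ^ (n / 2) := by
        refine sum_le_sum fun p hp => ?_
        have hMp : (M : ℚ) ^ (p / 2) ≤ (M : ℚ) ^ (n / 2) :=
          pow_le_pow_right₀ hM' (Nat.div_le_div_right (Nat.lt_succ_iff.1 (mem_range.1 hp)))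
        split_ifs with hpe
        · rw [abs_mul, abs_mul, abs_of_nonneg (by positivity : (0 : ℚ) ≤ 2 ^ w),
            abs_of_nonneg (by positivity : (0 : ℚ) ≤ (M : ℚ) ^ (p / 2))]
          exact mul_le_mul_of_nonneg_left hMp (by positivity)
        · rw [abs_zero]; positivity
    _ = (∑ p ∈ range (n + 1), |c o p|) * 2 ^ w * (M : ℚ) ^ (n / 2) := by rw [sum_mul, sum_mul]
    _ ≤ BallRivoal.l1 n w c * 2 ^ w * (M : ℚ) ^ (n / 2) := by
        refine mul_le_mul_of_nonneg_right (mul_le_mul_of_nonneg_right ?_ (by positivity))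
          (by positivity)
        rw [BallRivoal.l1]
        calc ∑ p ∈ range (n + 1), |c o p|
            = ∑ p ∈ range (n + 1), ∑ o' ∈ ({o} : Finset ℕ), |c o' p| := by simp
          _ ≤ ∑ p ∈ range (n + 1), ∑ o' ∈ range w, |c o' p| :=
              sum_le_sum fun p _ => sum_le_sum_of_subset_of_nonneg
                (by simpa using ho) fun _ _ _ => abs_nonneg _

/-- The crude bound on the factors of the `ℓ¹`-estimate of the parity kernel's partial-fraction data:
`∏_{s<w} 2^{(2s+5)n+1} ≤ 2^{w((2w+3)n+1)}` (termwise `2s + 5 ≤ 2w + 3` for `s < w`). [folklore] -/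
theorem prod_two_pow_le (w n : ℕ) :
    ∏ s ∈ Finset.range w, (2 : ℚ) ^ ((2 * s + 5) * n + 1) ≤ (2 : ℚ) ^ (w * ((2 * w + 3) * n + 1)) := by
  calc ∏ s ∈ range w, (2 : ℚ) ^ ((2 * s + 5) * n + 1)
      ≤ ∏ s ∈ range w, (2 : ℚ) ^ ((2 * w + 3) * n + 1) := by
        refine prod_le_prod (fun s _ => by positivity) fun s hs => ?_
        rw [mem_range] at hs
        exact pow_le_pow_right₀ one_le_two
          (Nat.add_le_add_right (Nat.mul_le_mul_right n (by omega)) 1)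
    _ = (2 : ℚ) ^ (w * ((2 * w + 3) * n + 1)) := by
        rw [prod_const, card_range, ← pow_mul, mul_comm]

end ParityPade

end Literature.NumberTheory.DiophantineApproximation
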